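import Summits.MatrixMultiplication.MatrixMultiplication.Theses.OctaveBudget
import HarnessLib

/-!
# OctaveBudgetAssembly — the assembly item of the octave budget is its deciding theorem
(decomp-mm cell, lens 5 «finite/base range + asymptotic regime + bridge», generation 10)

Landing form for item `stmt-MatrixMultiplication-26387` of `route-MatrixMultiplication-OctaveBudget`
(`Theses/OctaveBudget.lean`):

* `assembly_holds : Assembly` — `LinearExcessDecay → TailSubcriticalDoubling → SquareLink → ω = 2`,
  which is literally the statement of the route's certified deciding theorem `OctaveBudget.closes`
  (the octave sum `e(1) ≤ Σ_j e(2^j) − e(2^{j+1}) ≤ …`, telescoped against the budget `C/k`, pins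
  `e(2) = 0`, and `SquareLink` `(ω − 2)² ≤ e(2)` gives `ω = 2`).

References: [cite: Coppersmith1997, Thm 1]; [cite: HuangPan1998, §8];
[cite: VassilevskaWilliamsXuXuZhou2024, Table 1].
-/

set_option linter.dupNamespace false -- `MatrixMultiplication.MatrixMultiplication` (summit = problem, D-0017)

namespace Summit.MatrixMultiplication.MatrixMultiplication.Theorems.OctaveBudgetAssembly

open Summit.MatrixMultiplication.MatrixMultiplication.Theses.OctaveBudget

/-- Item `stmt-MatrixMultiplication-26387`: the assembly `LinearExcessDecay → TailSubcriticalDoubling →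
SquareLink → MatrixMultiplication` is the route's deciding theorem `closes`. -/
theorem assembly_holds : Assembly := fun h₁ h₂ h₃ => closes h₁ h₂ h₃

end Summit.MatrixMultiplication.MatrixMultiplication.Theorems.OctaveBudgetAssembly
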